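import Summits.BirchSwinnertonDyer.Rank1Residual.Additive.DictionaryUniform
import Summits.BirchSwinnertonDyer.Rank1Residual.Additive.PotentiallyOrdinaryTypeG
import Summits.BirchSwinnertonDyer.Rank1Residual.Additive.SubGordHigherOrdinary
import HarnessLib

/-!
# The open classes O5 (TAME potentially SUPERSINGULAR additive `p`) and O6 (WILD `p = 3`) of the residual map, part 1/2 — predicates and SUB-PARTITION (cell `b2b-bsdres`, lane CLASS-CLOSURE, seat cc-typer-5)

HONEST FRAMING (cell `b2b-bsdres`, run/shared/lean/b2b/bsd-rank1-residual/, verbatim in every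
file): the goal of the cell is to DELETE the COMBINATION-SHAPED residual classes of the
Birch–Swinnerton-Dyer formula for ALL analytic-rank `≤ 1` elliptic curves over `ℚ` — "full BSD
formula for every rank `≤ 1` curve in class `C`" assembled STRICTLY from published theorems — so
that the rank-`≤ 1` remainder becomes exactly the CONSTRUCTION-SHAPED classes, which are TYPED
(missing-input `Prop`s), NOT attempted. This is not "finishing BSD". Lane CLASS-CLOSURE
(coordinator ruling 2026-08-21T04:07:19Z; `CLASS-CLOSURE-PLAN.md` §3.4 O6 / §3.5 O5): research
routes; no claim beyond the stated classes; census output is EVIDENCE, never a Literature fact;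
nothing in this file moves a label of `RESIDUAL-MAP.md` and nothing is booked here.

This file TYPES the two OPEN classes of `RESIDUAL-MAP.md` §I at a potentially good SUPERSINGULAR
additive prime, in the cell's vocabulary (`Rank1Residual/Predicates.lean`: `Addv`, `ClassX3`,
`ClassX4`; `Additive/SharpenedStatements.lean` §1: `PotMult` (`ord_p j < 0`), `CondExpTwo`
(`f_p = 2`), `semistabilityIndex` (`e`), the census cells `SubM`/`SubGord`/`SubTprime`/`SubW`,
`SubGordTwo`/`SubGordHigher`; `Additive/PotGoodOrdinary.lean`: Delbourgo's `TypeG`, `TypeGOrd`):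

* **O5** = `X3 ∪ X4` at an odd additive `p`, TAME (`f_p = 2`), potentially good SUPERSINGULAR
  = the census cells `(t′)` ∪ `((G) ∧ ss)` (RESIDUAL-MAP §I O5, rmap-2 SIGNED §D: "TAME potentially
  supersingular = (t′) ∪ ((G) ∧ ss)"; S-b counts, two-engine `b2b-bsdres-rmap-2/census/addsplit_rmap2.md`
  on `sweep/v4f/RESIDUE.jsonl` sha256 `94a3b5a580462fc5…`: X4 `5 992` pairs at `p ≥ 5` — of which
  `770` are `(G) ∧ ss`, `e = 2` — `+ 40 788` at `p = 3`; X3 `1 063` at `p ≥ 5` `+ 5 279` at `p = 3`);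
* **O6** = `X3 ∪ X4` at a WILD additive prime (`f_p ≠ 2`: then `p = 3`, `v₃(N) ∈ {3,4,5}`) = the
  census cell `(w)` (RESIDUAL-MAP §I O6; S-b: X4 `60 568` pairs (`r0/r1` `55 220/5 348`), X3
  `18 852` (`9 476/9 376`)).

Contents (definitions + propositional bookkeeping + instantiations of EXISTING tree theorems; no
named fact; nothing asserted) — the SUB-PARTITION (deliverable (b) of the lane): `SubGordOrd`
((G-ord) proper = `SubGord ∧ TypeGOrd`: the territory of N10/N11/O7-ord), `SubGss`
(`(G) ∧ ss` = `SubGord ∧ ¬TypeGOrd`), `SubTameSS := SubGss ∨ SubTprime` (the O5 locus),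
`ClassO5`, `ClassO6`; the partition of the odd additive locus into FIVE census cells
`SubM ∨ SubGordOrd ∨ SubGss ∨ SubTprime ∨ SubW` (`addv_cells_exhaustive`, refining
`sub_exhaustive`) with disjointness (`subGss_disjoint`), hence `(M) ∨ (G-ord) ∨ O5 ∨ O6`
(`addv_odd_cells`); `ClassO5 ↔ p ≠ 2 ∧ Addv ∧ f_p = 2 ∧ ¬PotMult ∧ ¬TypeGOrd` (`classO5_iff`:
"tame, potentially good, not potentially good ordinary"); and the structure theorems
**`SubGss → SubGordTwo`** (at EVERY odd additive `p` the cell `(G) ∧ ss` is Kodaira `I₀*`: `E` is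
the quadratic twist by `χ_{p*}` of a curve with GOOD SUPERSINGULAR reduction at `p` — gen 3's
`typeGOrd_of_addv_of_subGordHigher` at `p ≥ 5`, gen 8's `not_subGordHigher_three` at `p = 3`),
**`ClassX3 → ¬SubGss`** (`(G) ∧ ss` is EMPTY on the Eisenstein class — `classX3Gord_iff_subGord`;
so `O5 ∩ X3 = X3 ∩ (t′)`, matching the hyp seat's `X3SharpTprime`), **`ClassO6 → p = 3 ∧ ¬TypeG W 3`**
(the wild class is `p = 3` and lies outside Delbourgo's (G): `not_subW_of_addv_of_five_le`,
`condExpTwo_three_of_typeG_of_addv`). The (t′) cell (`e ∈ {3,4,6}`, `e ∤ p − 1`; at `p = 3`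
Kodaira III/III*, `e = 4`) admits NO quadratic twist or abelian base change to a semistable
situation (a tame abelian ramification index at `p` divides `p − 1`): it is the IRREDUCIBLE
residue of O5. Targets, conjecture slots, the Kato reduction to the lower half and the Milne twist
transport are in part 2 (`Additive/PotSupersingularTargets.lean`); the finer split of O6 by
Kraus's inertia classification at `3` is the business of `Additive/WildThreeKrausCells.lean`.

References: RESIDUAL-MAP.md §D (SIGNED rmap-2; CORNER PREDICATES D-iii/D-iv), §I O5/O6;
CLASS-CLOSURE-PLAN.md §3.4–§3.5; D. Delbourgo, Compositio Math. 113 (1998) §1.5 (G), Thm. 1,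
p. 152 [Delbourgo1998]; J. H. Silverman, *ATAEC* IV.10.4 [SilvermanATAEC1994]; A. Kraus,
Manuscripta Math. 69 (1990) (p = 3 table, via N. Coppola, Acta Arith. 2020 Thm. 2.7);
HOME/class-closure/O5/TYPED.md, O6/TYPED.md (this seat).
-/

noncomputable section

open scoped Classical NumberField

open WeierstrassCurve IsDedekindDomain NumberField Literature.NumberTheory.EllipticCurves
  Literature.NumberTheory.EllipticCurves.ModularForms
  Literature.NumberTheory.EllipticCurves.Rank1Residual
  Literature.NumberTheory.EllipticCurves.Rank1Residual.Typed

namespace Summit.BirchSwinnertonDyer.Rank1Residual.Additive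

/-! ## §1 Predicates and the sub-partition of the odd additive locus -/

section Cells

variable (W : WeierstrassCurve ℚ) [W.IsElliptic] [W.IsGloballyMinimal] (p : ℕ) [hp : Fact p.Prime]

/-- Census cell **(G-ord) proper**: Delbourgo's (G) WITH potentially good ORDINARY reduction —
`SubGord W p ∧ TypeGOrd W p`. This is the territory of N10/N11 (`r = 0`) and O7-ord (`r = 1`) of
RESIDUAL-MAP §I, typed in `PotGoodOrdinary.lean` (`ClassX3Gord`/`ClassX4Gord`); recorded here only
to state the five-cell partition. [folklore] -/
def SubGordOrd : Prop := SubGord W p ∧ TypeGOrd W p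

/-- Census cell **(G) ∧ ss**: Delbourgo's hypothesis (G) holds (`SubGord W p`: `ord_p j ≥ 0`,
`f_p = 2`, `e ∣ p − 1`) but the potential good reduction above `p` is NOT ordinary
(`¬ TypeGOrd W p`) — i.e. SUPERSINGULAR. By `SubGss.subGordTwo` below this forces `e = 2`
(Kodaira `I₀*`): `E` is the quadratic twist by `χ_{p*}` of a curve `V` with GOOD SUPERSINGULAR
reduction at `p` (`a_p(V) = 0` for `p ≥ 5`; `a₃(V) ∈ {0, ±3}` at `p = 3`). S-b census (two-engine,
`addsplit_rmap2.md`): X4 `770` pairs at `p ≥ 5` (`415/29 @5`, `139/1 @7`, `185/1 @≥11`, `r0/r1`);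
EMPTY on X3 (`not_subGss_of_classX3`). The first transport candidate of CLASS-CLOSURE-PLAN §3.5.
[folklore] -/
def SubGss : Prop := SubGord W p ∧ ¬ TypeGOrd W p

/-- **The O5 locus: TAME potentially SUPERSINGULAR** = `(G) ∧ ss` ∪ `(t′)` (RESIDUAL-MAP §I O5:
"TAME potentially supersingular = (t′) ∪ ((G) ∧ ss)"). Equivalently (`subTameSS_iff`, odd additive
`p`): `f_p = 2 ∧ ord_p j ≥ 0 ∧ ¬ TypeGOrd`. [folklore] -/
def SubTameSS : Prop := SubGss W p ∨ SubTprime W p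

/-- **Class O5** (RESIDUAL-MAP §I; mark OPEN): `X3 ∪ X4` at an ODD additive prime of TAME
potentially SUPERSINGULAR type — `p ≠ 2 ∧ Addv W p ∧ SubTameSS W p` (`X3 ∪ X4` at odd `p` is
exactly `Addv`, `classX3_or_classX4_iff_addv`). S-b: X4 `5 992 @≥5 + 40 788 @3`, X3
`1 063 @≥5 + 5 279 @3`. A class predicate; nothing asserted. [folklore] -/
def ClassO5 : Prop := p ≠ 2 ∧ Addv W p ∧ SubTameSS W p

/-- **Class O6** (RESIDUAL-MAP §I; mark OPEN): `X3 ∪ X4` at an odd additive prime of WILD type —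
`p ≠ 2 ∧ Addv W p ∧ SubW W p` (`SubW`: `ord_p j ≥ 0 ∧ f_p ≠ 2`); then `p = 3` and
`v₃(N) ∈ {3, 4, 5}` (`ClassO6.p_eq_three`). S-b: X4 `60 568` (`55 220/5 348`), X3 `18 852`
(`9 476/9 376`). Nothing is formulated in print for the SIGNED theory here; Kato's Conj. 12.10 is
(module docstring). A class predicate; nothing asserted. [folklore] -/
def ClassO6 : Prop := p ≠ 2 ∧ Addv W p ∧ SubW W p

omit [W.IsElliptic] [W.IsGloballyMinimal] in
/-- At an odd prime, `X3 ∪ X4` is the whole additive locus (`Red ∨ Irr` is a tautology). [folklore] -/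
theorem classX3_or_classX4_iff_addv (hp2 : p ≠ 2) : ClassX3 W p ∨ ClassX4 W p ↔ Addv W p := by
  constructor
  · rintro (⟨-, h⟩ | ⟨-, h, -⟩) <;> exact h
  · intro h
    by_cases hi : Irr W p
    · exact Or.inr ⟨hp2, h, hi⟩
    · exact Or.inl ⟨hi, h⟩

/-- **The five census cells cover every pair**: (M) ∨ (G-ord proper) ∨ ((G) ∧ ss) ∨ (t′) ∨ (w)
(`sub_exhaustive` with (G) split along `TypeGOrd`). [folklore] -/
theorem addv_cells_exhaustive :
    SubM W p ∨ SubGordOrd W p ∨ SubGss W p ∨ SubTprime W p ∨ SubW W p := by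
  rcases sub_exhaustive W p with h | h | h | h
  · exact Or.inl h
  · by_cases hG : TypeGOrd W p
    · exact Or.inr (Or.inl ⟨h, hG⟩)
    · exact Or.inr (Or.inr (Or.inl ⟨h, hG⟩))
  · exact Or.inr (Or.inr (Or.inr (Or.inl h)))
  · exact Or.inr (Or.inr (Or.inr (Or.inr h)))

/-- The two halves of (G) are disjoint, and each is disjoint from (M), (t′), (w). [folklore] -/
theorem subGss_disjoint :
    (SubGss W p → ¬ SubGordOrd W p ∧ ¬ SubM W p ∧ ¬ SubTprime W p ∧ ¬ SubW W p) ∧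
    (SubGordOrd W p → ¬ SubM W p ∧ ¬ SubTprime W p ∧ ¬ SubW W p) := by
  have h1 := subM_disjoint W p
  have h2 := subGord_subTprime_subW_disjoint W p
  unfold SubGss SubGordOrd
  tauto

/-- **(t′) is never (G)-ordinary, at every odd additive prime** (`p ≥ 5`: gen 9's
`SubTprime.not_typeGOrd`; `p = 3`: (t′) misses the cell (G-ord) = (G) (`subGord_three_iff_typeG`),
and `TypeGOrd → TypeG`). [folklore] -/
theorem SubTprime.not_typeGOrd_of_addv (hp2 : p ≠ 2) (hadd : Addv W p) (hT : SubTprime W p) :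
    ¬ TypeGOrd W p := by
  rcases eq_three_or_five_le_of_prime_ne_two p hp.out hp2 with h3 | hp5
  · subst h3
    intro hG
    have hS : SubGord W 3 := (subGord_three_iff_typeG W hadd).mpr hG.typeG
    exact ((subGord_subTprime_subW_disjoint W 3).1 hS).1 hT
  · exact SubTprime.not_typeGOrd W p hp5 hT

/-- **The O5 locus in words**: at an odd additive `p`, `SubTameSS W p ↔ f_p = 2 ∧ ord_p j ≥ 0 ∧
¬ TypeGOrd W p` — "tame, potentially good, not potentially good ordinary". [folklore] -/
theorem subTameSS_iff (hp2 : p ≠ 2) (hadd : Addv W p) :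
    SubTameSS W p ↔ CondExpTwo W p ∧ ¬ PotMult W p ∧ ¬ TypeGOrd W p := by
  constructor
  · rintro (⟨hS, hG⟩ | hT)
    · exact ⟨hS.2.1, hS.1, hG⟩
    · exact ⟨hT.2.1, hT.1, SubTprime.not_typeGOrd_of_addv W p hp2 hadd hT⟩
  · rintro ⟨hf, hj, hG⟩
    by_cases he : semistabilityIndex W p ∣ p - 1
    · exact Or.inl ⟨⟨hj, hf, he⟩, hG⟩
    · exact Or.inr ⟨hj, hf, he⟩

/-- **Class O5 in words**: `p ≠ 2 ∧ Addv ∧ f_p = 2 ∧ ord_p j ≥ 0 ∧ ¬ TypeGOrd`. [folklore] -/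
theorem classO5_iff :
    ClassO5 W p ↔ p ≠ 2 ∧ Addv W p ∧ CondExpTwo W p ∧ ¬ PotMult W p ∧ ¬ TypeGOrd W p := by
  constructor
  · rintro ⟨hp2, hadd, hS⟩
    exact ⟨hp2, hadd, (subTameSS_iff W p hp2 hadd).mp hS⟩
  · rintro ⟨hp2, hadd, h⟩
    exact ⟨hp2, hadd, (subTameSS_iff W p hp2 hadd).mpr h⟩

variable {W p}

/-- O5 pairs are additive at an odd prime. [folklore] -/
theorem ClassO5.addv (h : ClassO5 W p) : p ≠ 2 ∧ Addv W p := ⟨h.1, h.2.1⟩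

/-- O5 pairs are potentially good (`ord_p j ≥ 0`). [folklore] -/
theorem ClassO5.padicValRat_j_nonneg (h : ClassO5 W p) : 0 ≤ padicValRat p W.j :=
  not_lt.mp ((classO5_iff W p).mp h).2.2.2.1

/-- O5 pairs are tame (`f_p = 2`). [folklore] -/
theorem ClassO5.condExpTwo (h : ClassO5 W p) : CondExpTwo W p := ((classO5_iff W p).mp h).2.2.1

/-- O5 pairs are not potentially good ordinary. [folklore] -/
theorem ClassO5.not_typeGOrd (h : ClassO5 W p) : ¬ TypeGOrd W p := ((classO5_iff W p).mp h).2.2.2.2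

/-- O5 is disjoint from the potentially multiplicative cell (M) and from the wild cell (w). [folklore] -/
theorem ClassO5.not_subM_not_subW (h : ClassO5 W p) : ¬ SubM W p ∧ ¬ SubW W p := by
  rcases h.2.2 with hG | hT
  · exact ⟨((subGss_disjoint W p).1 hG).2.1, ((subGss_disjoint W p).1 hG).2.2.2⟩
  · exact ⟨fun hM ↦ ((subM_disjoint W p) hM).2.1 hT, (subGord_subTprime_subW_disjoint W p).2 hT⟩

omit [W.IsGloballyMinimal] in
/-- O6 pairs are additive at an odd prime, potentially good, with `f_p ≠ 2`. [folklore] -/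
theorem ClassO6.addv (h : ClassO6 W p) : p ≠ 2 ∧ Addv W p ∧ ¬ PotMult W p ∧ ¬ CondExpTwo W p :=
  ⟨h.1, h.2.1, h.2.2.1, h.2.2.2⟩

omit [W.IsGloballyMinimal] in
/-- O6 pairs are potentially good (`ord_p j ≥ 0`). [folklore] -/
theorem ClassO6.padicValRat_j_nonneg (h : ClassO6 W p) : 0 ≤ padicValRat p W.j := not_lt.mp h.2.2.1

omit [W.IsGloballyMinimal] in
/-- **The wild class lives at `p = 3`**: an additive `p ≥ 5` has `f_p = 2`
(`not_subW_of_addv_of_five_le`, Silverman *ATAEC* IV.10.4). [cite: SilvermanATAEC1994, IV.10.4] -/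
theorem ClassO6.p_eq_three (h : ClassO6 W p) : p = 3 := by
  rcases eq_three_or_five_le_of_prime_ne_two p hp.out h.1 with h3 | hp5
  · exact h3
  · exact absurd h.2.2 (not_subW_of_addv_of_five_le W p hp5 h.2.1)

/-- **The wild class is outside Delbourgo's (G)** (and a fortiori not (G)-ordinary): a type-(G) pair
at `3` is tame (`condExpTwo_three_of_typeG_of_addv`). So O6 is potentially supersingular with good
reduction attained over NO subfield of `ℚ(ζ₃)`; whether it is attained inside `ℚ(ζ₉)` is the
sub-partition `(G₉)` of the sibling file. [folklore] -/
theorem ClassO6.not_typeG_three (h : ClassO6 W 3) : ¬ TypeG W 3 ∧ ¬ TypeGOrd W 3 :=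
  have hG : ¬ TypeG W 3 := fun hG ↦ h.2.2.2 (condExpTwo_three_of_typeG_of_addv W hG h.2.1)
  ⟨hG, fun hGo ↦ hG hGo.typeG⟩

/-- O5 and O6 are disjoint (tame versus wild). [folklore] -/
theorem ClassO5.not_classO6 (h : ClassO5 W p) : ¬ ClassO6 W p := fun h6 ↦ h.not_subM_not_subW.2 h6.2.2

variable (W p)

/-- **The odd additive locus is (M) ∪ (G-ord proper) ∪ O5 ∪ O6** — the map's cells N10/N11/O7-ord
((M), (G-ord)) versus O5 (tame supersingular) versus O6 (wild), losing no pair. [folklore] -/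
theorem addv_odd_cells (hp2 : p ≠ 2) (hadd : Addv W p) :
    SubM W p ∨ SubGordOrd W p ∨ ClassO5 W p ∨ ClassO6 W p := by
  rcases addv_cells_exhaustive W p with h | h | h | h | h
  · exact Or.inl h
  · exact Or.inr (Or.inl h)
  · exact Or.inr (Or.inr (Or.inl ⟨hp2, hadd, Or.inl h⟩))
  · exact Or.inr (Or.inr (Or.inl ⟨hp2, hadd, Or.inr h⟩))
  · exact Or.inr (Or.inr (Or.inr ⟨hp2, hadd, h⟩))

/-! ### Structure of the cell `(G) ∧ ss` -/

/-- **`(G) ∧ ss` is Kodaira `I₀*` at every odd additive prime**: `SubGss W p → SubGordTwo W p`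
(`e = 2`). At `p ≥ 5` a (G)-pair with `e ∈ {3, 4, 6}` is ORDINARY (`j̃ ∈ {0, 1728}` with
`p ≡ 1 (mod 3)` resp. `(mod 4)`: gen 3's `typeGOrd_of_addv_of_subGordHigher`); at `p = 3` the cell
(G) is entirely `I₀*` (`not_subGordHigher_three`). Hence on `(G) ∧ ss` the twist `E^{(p*)}` has
GOOD reduction at `p` (and it is supersingular since `E` is not (G)-ordinary:
`typeGOrd_iff_goodOrd_twist_pStar`, `typeGOrd_three_iff_goodOrd_twist`). [folklore] -/
theorem SubGss.subGordTwo (hp2 : p ≠ 2) (hadd : Addv W p) (h : SubGss W p) : SubGordTwo W p := by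
  rcases eq_three_or_five_le_of_prime_ne_two p hp.out hp2 with h3 | hp5
  · subst h3
    by_contra hne
    exact not_subGordHigher_three W hadd ⟨h.1, fun he ↦ hne ⟨h.1, he⟩⟩
  · by_contra hne
    exact h.2 (typeGOrd_of_addv_of_subGordHigher W p hp5 hadd ⟨h.1, fun he ↦ hne ⟨h.1, he⟩⟩)

/-- `(G) ∧ ss` pairs are of Delbourgo's type (G) (`subGord_iff_typeG_of_addv`) — the hypothesis of
Delbourgo 1998 Thm. 1 (a unique `1`-admissible measure `μ_E`; Compositio 113 p. 131).
[cite: Delbourgo1998, §1.5 (G) and Thm. 1] -/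
theorem SubGss.typeG (hp2 : p ≠ 2) (hadd : Addv W p) (h : SubGss W p) : TypeG W p :=
  (subGord_iff_typeG_of_addv W p hp2 hadd).mp h.1

/-- **`(G) ∧ ss` is EMPTY on the Eisenstein class X3** (a curve with a rational `p`-isogeny and good
reduction over a subfield of `ℚ(ζ_p)` is ordinary there: `classX3Gord_iff_subGord`, every odd `p`;
census `0 ‖ 0`, rmap-2 SIGNED §D (1)). So `O5 ∩ X3 = X3 ∩ (t′)`. [folklore] -/
theorem not_subGss_of_classX3 (hp2 : p ≠ 2) (hX : ClassX3 W p) : ¬ SubGss W p := fun h ↦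
  h.2 ((classX3Gord_iff_subGord W p hp2 hX).mpr h.1).2

/-- On X3, class O5 is exactly the census cell (t′). [folklore] -/
theorem classO5_iff_subTprime_of_classX3 (hp2 : p ≠ 2) (hX : ClassX3 W p) :
    ClassO5 W p ↔ SubTprime W p :=
  ⟨fun h ↦ h.2.2.resolve_left (not_subGss_of_classX3 W p hp2 hX), fun hT ↦ ⟨hp2, hX.2, Or.inr hT⟩⟩

/-- On X4, `(G) ∧ ss` is `(G)` minus X4♯(G-ord): `SubGss W p ↔ SubGord W p ∧ ¬ ClassX4Gord W p`.
[folklore] -/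
theorem subGss_iff_of_classX4 (hX : ClassX4 W p) : SubGss W p ↔ SubGord W p ∧ ¬ ClassX4Gord W p :=
  ⟨fun h ↦ ⟨h.1, fun hG ↦ h.2 hG.2⟩, fun h ↦ ⟨h.1, fun hG ↦ h.2 ⟨hX, hG⟩⟩⟩

end Cells


end Summit.BirchSwinnertonDyer.Rank1Residual.Additive

end
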